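import Mathlib

/-!
# SoloBlind — discrete Liouville–Green bookkeeping for the outer zone ([O1], PLAN §119.11–119.12)

Exact algebra behind the Volterra representation of the recessive solution of a three-term recurrence
`w (k+2) = β (k+1) * w (k+1) - w k` relative to a comparison sequence `P` (the discrete LG ansatz
`P k = (β k ^ 2 - 4)^(-1/4) · λ k ^ (1/2) · ∏_{j<k} λ j`, see the notes):

* `volterra_step` — if `w = P * (1 + ε)` solves the recurrence and `r (k+1) := P (k+2) - β (k+1) P (k+1) + P k` is the
  one-step residual of `P`, then `D (k+1) - D k = - P (k+1) * r (k+1) * (1 + ε (k+1))` for the weighted differences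
  `D k := P k * P (k+1) * (ε (k+1) - ε k)` — the telescoping identity that turns the recurrence for `ε` into a summation
  (Volterra) equation;
* `volterra_sum` — the summed form over a finite range;
* `charroot_sq_sub` — for a characteristic root `λ` of `λ + λ⁻¹ = β` one has `(λ - λ⁻¹)^2 = β^2 - 4`, whence the
  modulus identity `‖f‖^4 * ‖λ - λ⁻¹‖^2 = 1` for any `f` with `f^4 * (β^2 - 4) = 1` (`amplitude_modulus_identity`): the LG
  amplitude and the local "momentum" cancel exactly, which is what makes the inner Volterra sums uniformly bounded;
* `frozen_inner_sum` — the frozen-coefficient inner sum `∑_{i<j} λ^(2(j-i)-1) = λ (1 - λ^(2j)) / (1 - λ^2)` and its bound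
  `‖·‖ ≤ 2 / ‖λ⁻¹ - λ‖` for `‖λ‖ ≤ 1`, `λ^2 ≠ 1`, `λ ≠ 0` (the factor 2 measured for `x < 0`).
Pure algebra over `ℂ`.
-/

namespace Summit.AnomalousDissipation.SoloBlind.DiscreteLG

open Complex Finset

/-- Telescoping (Volterra) step: the recurrence for the relative error `ε` of a comparison sequence `P`. -/
theorem volterra_step (w P ε β r : ℕ → ℂ)
    (hw : ∀ k, w k = P k * (1 + ε k))
    (hrec : ∀ k, w (k + 2) = β (k + 1) * w (k + 1) - w k)
    (hr : ∀ k, r (k + 1) = P (k + 2) - β (k + 1) * P (k + 1) + P k) (k : ℕ) :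
    P (k + 1) * P (k + 2) * (ε (k + 2) - ε (k + 1)) - P k * P (k + 1) * (ε (k + 1) - ε k)
      = - (P (k + 1) * r (k + 1) * (1 + ε (k + 1))) := by
  have h := hrec k
  rw [hw (k + 2), hw (k + 1), hw k] at h
  rw [hr k]
  linear_combination (P (k + 1)) * h

/-- Summed form: `D n - D m = - ∑_{k ∈ [m, n)} P (k+1) r (k+1) (1 + ε (k+1))` with `D k = P k P (k+1) (ε (k+1) - ε k)`. -/
theorem volterra_sum (w P ε β r : ℕ → ℂ)
    (hw : ∀ k, w k = P k * (1 + ε k))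
    (hrec : ∀ k, w (k + 2) = β (k + 1) * w (k + 1) - w k)
    (hr : ∀ k, r (k + 1) = P (k + 2) - β (k + 1) * P (k + 1) + P k) (m n : ℕ) (hmn : m ≤ n) :
    P n * P (n + 1) * (ε (n + 1) - ε n) - P m * P (m + 1) * (ε (m + 1) - ε m)
      = - ∑ k ∈ Finset.Ico m n, P (k + 1) * r (k + 1) * (1 + ε (k + 1)) := by
  induction n, hmn using Nat.le_induction with
  | base => simp
  | succ n hmn ih =>
    rw [Finset.sum_Ico_succ_top hmn, neg_add, ← ih, ← volterra_step w P ε β r hw hrec hr n]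
    ring

/-- A characteristic root: `λ + λ⁻¹ = β` gives `(λ - λ⁻¹)^2 = β^2 - 4`. -/
theorem charroot_sq_sub (l β : ℂ) (hl : l ≠ 0) (hβ : l + l⁻¹ = β) :
    (l - l⁻¹) ^ 2 = β ^ 2 - 4 := by
  rw [← hβ]
  have : l * l⁻¹ = 1 := mul_inv_cancel₀ hl
  linear_combination (-4 : ℂ) * this

/-- The LG amplitude/momentum cancellation: if `f^4 (β^2 - 4) = 1` and `λ + λ⁻¹ = β` then `‖f‖^4 ‖λ - λ⁻¹‖^2 = 1`. -/
theorem amplitude_modulus_identity (f l β : ℂ) (hl : l ≠ 0) (hβ : l + l⁻¹ = β)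
    (hf : f ^ 4 * (β ^ 2 - 4) = 1) :
    ‖f‖ ^ 4 * ‖l - l⁻¹‖ ^ 2 = 1 := by
  have h1 : f ^ 4 * (l - l⁻¹) ^ 2 = 1 := by rw [charroot_sq_sub l β hl hβ]; exact hf
  have h2 : ‖f ^ 4 * (l - l⁻¹) ^ 2‖ = 1 := by rw [h1]; simp
  simpa [norm_mul, norm_pow] using h2

/-- Frozen-coefficient inner sum (closed form): `∑_{i<j} λ^(2(j-i)-1) = λ (1 - λ^(2j)) / (1 - λ^2)`. -/
theorem frozen_inner_sum (l : ℂ) (hl2 : l ^ 2 ≠ 1) (j : ℕ) :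
    ∑ i ∈ Finset.range j, l ^ (2 * (j - i) - 1) = l * (1 - l ^ (2 * j)) / (1 - l ^ 2) := by
  have h1 : (1 : ℂ) - l ^ 2 ≠ 0 := sub_ne_zero.mpr (Ne.symm hl2)
  rw [eq_div_iff h1]
  -- reindex i ↦ j - 1 - i : the sum is ∑_{m<j} λ^(2m+1)
  have hre : ∑ i ∈ Finset.range j, l ^ (2 * (j - i) - 1) = ∑ m ∈ Finset.range j, l ^ (2 * m + 1) := by
    rw [← Finset.sum_range_reflect]
    refine Finset.sum_congr rfl (fun m hm => ?_)
    rw [Finset.mem_range] at hm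
    congr 1
    omega
  rw [hre]
  have hgeom : ∀ n : ℕ, (∑ m ∈ Finset.range n, l ^ (2 * m + 1)) * (1 - l ^ 2) = l * (1 - l ^ (2 * n)) := by
    intro n
    induction n with
    | zero => simp
    | succ n ih =>
      rw [Finset.sum_range_succ, add_mul, ih]
      ring
  exact hgeom j

/-- Its bound for a recessive multiplier: `‖λ‖ ≤ 1`, `λ ≠ 0`, `λ^2 ≠ 1` ⇒ `‖∑_{i<j} λ^(2(j-i)-1)‖ ≤ 2 / ‖λ⁻¹ - λ‖`. -/
theorem frozen_inner_sum_bound (l : ℂ) (hl : l ≠ 0) (hl1 : ‖l‖ ≤ 1) (hl2 : l ^ 2 ≠ 1) (j : ℕ) :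
    ‖∑ i ∈ Finset.range j, l ^ (2 * (j - i) - 1)‖ ≤ 2 / ‖l⁻¹ - l‖ := by
  rw [frozen_inner_sum l hl2 j]
  have hkey : l * (1 - l ^ (2 * j)) / (1 - l ^ 2) = (1 - l ^ (2 * j)) / (l⁻¹ - l) := by
    have h4 : (1 : ℂ) - l ^ 2 = l * (l⁻¹ - l) := by rw [mul_sub, mul_inv_cancel₀ hl]; ring
    rw [h4]
    exact mul_div_mul_left _ _ hl
  rw [hkey, norm_div]
  have hnum : ‖1 - l ^ (2 * j)‖ ≤ 2 := by
    calc ‖1 - l ^ (2 * j)‖ ≤ ‖(1 : ℂ)‖ + ‖l ^ (2 * j)‖ := norm_sub_le _ _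
      _ ≤ 1 + 1 := by
          rw [norm_one, norm_pow]
          exact add_le_add le_rfl (pow_le_one₀ (norm_nonneg _) hl1)
      _ = 2 := by norm_num
  have hden : 0 < ‖l⁻¹ - l‖ := by
    rw [norm_pos_iff]
    intro h
    apply hl2
    have : l⁻¹ = l := sub_eq_zero.mp h
    calc l ^ 2 = l * l := sq l
      _ = l * l⁻¹ := by rw [this]
      _ = 1 := mul_inv_cancel₀ hl
  exact div_le_div_of_nonneg_right hnum hden.le

end Summit.AnomalousDissipation.SoloBlind.DiscreteLG
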